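import Literature.Topology.PlanarFoliations.StabilityBand
import Literature.Topology.FourManifolds.TautFoliationsFencePush
import Mathlib.Analysis.Convex.Contractible
import Mathlib.Topology.Algebra.Module.LocallyConvex
import HarnessLib

/-!
# Transport of null-homotopy across the band of closed leaves

Topic: Topology / PlanarFoliations. Let `F : Foliation ℝ X` be a planar foliation, `f` a
foliated map from `(X, F)` to a `C⁰` codimension-one foliation `T` of a space `M`
(`TautFoliationsFoliatedMaps.lean`), and `C` a closed fence over an injective leaf loop `γ`
of `F` (`StabilityBand.lean`: the fence with matched ends over `γ` closes up because the
holonomy of `γ` is trivial; its horizontals `h_τ = Φ(·, τ)` are leaf loops of `F` at the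
points `V τ` of the vertical through `γ 0`). **If the image loop `f ∘ γ` is null-homotopic
in its leaf of `T` (leaf topology), then so are the image loops `f ∘ h_τ` for all levels `τ`
near the base level** (`ClosedFence.exists_forall_homotopic_refl_map`).

This is the step "`g(γ_t)` is homotopic to a constant in `A_t`, which implies that `V_i` is
open" of the proof of the existence of vanishing cycles (Camacho–Lins Neto, *Geometric Theory
of Foliations*, Ch. VII §2 Prop. 1), there obtained from Lemma 4 of Ch. IV (a null-homotopy
disc in the leaf `A₀` extends to a family of discs in the nearby leaves) and the remark that
the boundaries `δ_t` of these discs are homotopic to `g(γ_t)` in `A_t` "because both tend to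
`g(γ₀)`". With fences the last remark becomes exact: the null-homotopy `H` of `f ∘ γ`, read
as a leaf map `g` from the square `[0, 1]²` equal to `f ∘ γ` along (a neighbourhood of) the
edge `t = 0` and constant on the three other edges, lifts to the germ space of `T`; the image
`f ∘ Φ` of the closed fence is a fence of `T` for this lift near the edge `t = 0`
(`TautFoliationsFencePush.lean`), and extends *relatively* to a fence `Ψ` over the whole
square (`exists_isFenceOn_univ_of_isFenceOn`). At a level `τ`, the horizontal `Ψ(·, τ)` is a
leaf map of the square into the leaf of `V τ`: along the edge `t = 0` it *is* `f ∘ h_τ`, and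
along the three other edges — where the lift is constant, the fibres of the germ covering
being discrete — it runs in a single plaque. In the simply connected square the edge `t = 0`
is homotopic with fixed ends to the path along the three other edges, so `f ∘ h_τ` is
homotopic in its leaf to a loop in a plaque, which is null-homotopic there
(`homotopic_refl_of_forall_mem_plaque`).

* `sqSet`, `Sq` (**definitions**): the parameter square as a convex compact subset of `ℝ²`
  (compact, Hausdorff, contractible hence simply connected, locally path connected), with
  its corner points, its coordinate `θ`, the edge `t = 0` as a path and the three other edges.
* `ClosedFence.horizPath` (**definition**): the horizontal of level `τ` of a closed fence as a
  leaf loop at `V τ`.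
* `ClosedFence.exists_forall_homotopic_refl_map` (**proved**): the transport theorem.

## References

* C. Camacho, A. Lins Neto, *Geometric Theory of Foliations*, Birkhäuser (1985), Ch. IV §2
  Lemma 4, Ch. VII §2 Prop. 1 [CamachoLinsNeto1985].
-/

noncomputable section

open Set Filter Function
open _root_.Topology unitInterval
open Literature.Topology.FourManifolds Literature.Topology.FourManifolds.Foliation

namespace Literature.Topology.PlanarFoliations

/-! ## The parameter square -/

/-- The unit square `[0, 1]²` in `ℝ²`. [folklore] -/
def sqSet : Set (ℝ × ℝ) := Icc (0 : ℝ) 1 ×ˢ Icc (0 : ℝ) 1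

/-- The unit square as a type. [folklore] -/
abbrev Sq : Type := ↥sqSet

/-- The unit square is convex. [folklore] -/
theorem convex_sqSet : Convex ℝ sqSet := (convex_Icc 0 1).prod (convex_Icc 0 1)

/-- The unit square is compact. [folklore] -/
theorem isCompact_sqSet : IsCompact sqSet := isCompact_Icc.prod isCompact_Icc

/-- The unit square is a compact space. [folklore] -/
instance : CompactSpace Sq := isCompact_iff_compactSpace.1 isCompact_sqSet

/-- A point of the square from two points of the unit interval: `(t, θ)`. [folklore] -/
def mkSq (t θ : I) : Sq := ⟨((t : ℝ), (θ : ℝ)), ⟨t.2, θ.2⟩⟩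

/-- The coordinates of `mkSq`. [folklore] -/
@[simp] theorem coe_mkSq (t θ : I) : ((mkSq t θ : Sq) : ℝ × ℝ) = ((t : ℝ), (θ : ℝ)) := rfl

/-- `mkSq` is continuous. [folklore] -/
theorem continuous_mkSq : Continuous fun p : I × I ↦ mkSq p.1 p.2 :=
  ((continuous_subtype_val.comp continuous_fst).prodMk
    (continuous_subtype_val.comp continuous_snd)).subtype_mk _

/-- The unit square is contractible (convex), hence simply connected. [folklore] -/
instance : ContractibleSpace Sq := convex_sqSet.contractibleSpace ⟨((0 : ℝ), (0 : ℝ)), (mkSq 0 0).2⟩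

/-- The unit square is locally path connected (convex). [folklore] -/
instance : LocallyPathConnectedSpace Sq := convex_sqSet.locallyPathConnectedSpace

/-- The angular coordinate `θ ∈ [0, 1]` of a point of the square. [folklore] -/
def θSq (a : Sq) : I := ⟨a.1.2, a.2.2⟩

/-- `θSq` is continuous. [folklore] -/
theorem continuous_θSq : Continuous θSq :=
  (continuous_snd.comp continuous_subtype_val).subtype_mk _

/-- `θSq (mkSq t θ) = θ`. [folklore] -/
@[simp] theorem θSq_mkSq (t θ : I) : θSq (mkSq t θ) = θ := Subtype.ext rfl

/-- The segment from `a` to `b` in the (convex) square, as a path. [folklore] -/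
def segSq (a b : Sq) : Path a b where
  toFun s := ⟨(1 - (s : ℝ)) • (a : ℝ × ℝ) + (s : ℝ) • (b : ℝ × ℝ),
    convex_sqSet a.2 b.2 (by linarith [s.2.2]) s.2.1 (by ring)⟩
  continuous_toFun := by
    refine Continuous.subtype_mk ?_ _
    have hs : Continuous fun s : I ↦ (s : ℝ) := continuous_subtype_val
    exact ((continuous_const.sub hs).smul continuous_const).add (hs.smul continuous_const)
  source' := by
    apply Subtype.ext
    show (1 - ((0 : I) : ℝ)) • (a : ℝ × ℝ) + ((0 : I) : ℝ) • (b : ℝ × ℝ) = a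
    simp
  target' := by
    apply Subtype.ext
    show (1 - ((1 : I) : ℝ)) • (a : ℝ × ℝ) + ((1 : I) : ℝ) • (b : ℝ × ℝ) = b
    simp

/-- The points of a segment. [folklore] -/
theorem coe_segSq (a b : Sq) (s : I) :
    ((segSq a b s : Sq) : ℝ × ℝ) = (1 - (s : ℝ)) • (a : ℝ × ℝ) + (s : ℝ) • (b : ℝ × ℝ) := rfl

/-- The edge `t = 0` of the square, run by `θ`, as a path from `(0, 0)` to `(0, 1)`. [folklore] -/
def edge₀ : Path (mkSq 0 0) (mkSq 0 1) where
  toFun θ := mkSq 0 θ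
  continuous_toFun := continuous_mkSq.comp (continuous_const.prodMk continuous_id)
  source' := rfl
  target' := rfl

/-- The values of `edge₀`. [folklore] -/
@[simp] theorem edge₀_apply (θ : I) : edge₀ θ = mkSq 0 θ := rfl

/-- The path from `(0, 0)` to `(0, 1)` along the three other edges `θ = 0`, `t = 1`, `θ = 1`.
[folklore] -/
def edge₃ : Path (mkSq 0 0) (mkSq 0 1) :=
  (segSq (mkSq 0 0) (mkSq 1 0)).trans ((segSq (mkSq 1 0) (mkSq 1 1)).trans (segSq (mkSq 1 1) (mkSq 0 1)))

/-- The three other edges, as a subset of the square. [folklore] -/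
def edgeSet : Set Sq := {a | (a : ℝ × ℝ).2 = 0 ∨ (a : ℝ × ℝ).1 = 1 ∨ (a : ℝ × ℝ).2 = 1}

/-- **The three-edge path runs in the three edges.** [folklore] -/
theorem range_edge₃_subset : range edge₃ ⊆ edgeSet := by
  rw [edge₃, Path.trans_range, Path.trans_range]
  rintro a (⟨s, rfl⟩ | ⟨s, rfl⟩ | ⟨s, rfl⟩)
  · left
    show ((1 - (s : ℝ)) • (((0 : I) : ℝ), ((0 : I) : ℝ)) + (s : ℝ) • (((1 : I) : ℝ), ((0 : I) : ℝ))).2 = 0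
    simp
  · right; left
    show ((1 - (s : ℝ)) • (((1 : I) : ℝ), ((0 : I) : ℝ)) + (s : ℝ) • (((1 : I) : ℝ), ((1 : I) : ℝ))).1 = 1
    simp
  · right; right
    show ((1 - (s : ℝ)) • (((1 : I) : ℝ), ((1 : I) : ℝ)) + (s : ℝ) • (((0 : I) : ℝ), ((1 : I) : ℝ))).2 = 1
    simp

/-- The corner `(0, 0)` lies in the three edges. [folklore] -/
theorem corner_mem_edgeSet : mkSq 0 0 ∈ edgeSet := Or.inl rfl

/-- **The three edges form a preconnected set** (three segments with common points). [folklore] -/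
theorem isPreconnected_edgeSet_range : IsPreconnected (range edge₃) :=
  isPreconnected_range edge₃.continuous

/-- The edge `t = 0` is homotopic, with fixed ends, to the path along the three other edges
(the square is simply connected). [folklore] -/
theorem homotopic_edge₀_edge₃ : edge₀.Homotopic edge₃ := SimplyConnectedSpace.paths_homotopic _ _

/-- The edge `t = 0` has first coordinate `0`. [folklore] -/
theorem mkSq_zero_fst (θ : I) : ((mkSq 0 θ : Sq) : ℝ × ℝ).1 = 0 := rfl

/-! ## The horizontal loops of a closed fence -/

variable {X : Type*} [TopologicalSpace X] {F : Foliation ℝ X} {x : X}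
variable {γ : ℝ → F.Leaf x} {e₀ : OpenPartialHomeomorph X (ℝ × ℝ)}

namespace ClosedFence

/-- **The horizontal of level `τ` of a closed fence as a leaf loop at `V τ`** (in the leaf
topology of `F`; the constant loop for levels outside the level interval). [folklore] -/
def horizPath (C : ClosedFence γ e₀) (τ : ℝ) :
    Path (toLeafSpace (vert γ e₀ τ) : F.LeafSpace) (toLeafSpace (vert γ e₀ τ)) :=
  if hτ : τ ∈ Ioo (baseLevel γ e₀ - C.ε) (baseLevel γ e₀ + C.ε) then
    { toFun := fun θ ↦ toLeafSpace (C.Φ θ τ)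
      continuous_toFun := C.continuous_toLeafSpace_Φ hτ
      source' := congrArg toLeafSpace (C.Φ_zero hτ)
      target' := congrArg toLeafSpace (C.Φ_one hτ) }
  else Path.refl _

/-- The values of the horizontal loop. [folklore] -/
theorem horizPath_apply (C : ClosedFence γ e₀) {τ : ℝ}
    (hτ : τ ∈ Ioo (baseLevel γ e₀ - C.ε) (baseLevel γ e₀ + C.ε)) (θ : I) :
    C.horizPath τ θ = toLeafSpace (C.Φ θ τ) := by
  rw [horizPath, dif_pos hτ]
  rfl

end ClosedFence

/-! ## The transport theorem -/

section Transport

variable {B : Type*} [NormedAddCommGroup B] [NormedSpace ℝ B] [LocallyConnectedSpace B]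
  {M : Type*} [TopologicalSpace M] {T : Foliation B M} {f : X → M}

/-- **Transport of null-homotopy across the band of closed leaves.** Let `f` be a foliated map
from the planar foliation `F` to `T`, `C` a closed fence over the injective leaf loop `γ` of
`F`, and suppose the image loop `f ∘ γ` is null-homotopic in the leaf topology of `T`. Then
for all levels `τ` near the base level, the image `f ∘ h_τ` of the horizontal loop of `C` at
`V τ` is null-homotopic in the leaf topology of `T` (Camacho–Lins Neto, Ch. VII §2, proof of
Prop. 1: "`g(γ_t)` is homotopic to a constant in `A_t`"; see the module docstring for the
fence proof). [cite: CamachoLinsNeto1985, Ch. VII §2 Prop. 1] -/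
theorem ClosedFence.exists_forall_homotopic_refl_map (hf : IsFoliatedMap F T f) (C : ClosedFence γ e₀)
    (hnull : ((F.leafLoop (loopPath γ C.cont C.per) (continuous_toLeafSpace_loopPath γ C.cont C.per)).map
      hf.continuous_leafMap).Homotopic (Path.refl _)) :
    ∃ δ > (0 : ℝ), δ ≤ C.ε ∧ ∀ τ ∈ Ioo (baseLevel γ e₀ - δ) (baseLevel γ e₀ + δ),
      ((C.horizPath τ).map hf.continuous_leafMap).Homotopic (Path.refl _) := by
  haveI : Nonempty B := ⟨0⟩
  obtain ⟨H⟩ := hnull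
  set τ₀ : ℝ := baseLevel γ e₀ with hτ₀def
  set L := F.leafLoop (loopPath γ C.cont C.per) (continuous_toLeafSpace_loopPath γ C.cont C.per) with hL
  set q₀ : T.LeafSpace := leafMap F T f (toLeafSpace (loopBase γ)) with hq₀
  -- the leaf map `g` of the square: `f ∘ γ` on the lower half, the null-homotopy above
  set gf : Sq → T.LeafSpace := fun a ↦ H (projIcc 0 1 zero_le_one (2 * (a : ℝ × ℝ).1 - 1), θSq a)
    with hgf
  have hgc : Continuous gf := by
    refine H.continuous.comp (Continuous.prodMk ?_ continuous_θSq)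
    exact continuous_projIcc.comp ((continuous_const.mul
      (continuous_fst.comp continuous_subtype_val)).sub continuous_const)
  set g : C(Sq, T.LeafSpace) := ⟨gf, hgc⟩ with hgdef
  have hg_low : ∀ a : Sq, (a : ℝ × ℝ).1 ≤ 1 / 2 → g a = leafMap F T f (toLeafSpace (C.Φ (θSq a) τ₀)) := by
    intro a ha
    show H (projIcc 0 1 zero_le_one (2 * (a : ℝ × ℝ).1 - 1), θSq a) = _
    rw [projIcc_of_le_left _ (by linarith), show (⟨0, left_mem_Icc.2 zero_le_one⟩ : I) = 0 from rfl,
      H.apply_zero, C.Φ_baseLevel]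
    rfl
  have hg_edge : ∀ a ∈ edgeSet, g a = q₀ := by
    intro a ha
    show H (projIcc 0 1 zero_le_one (2 * (a : ℝ × ℝ).1 - 1), θSq a) = q₀
    rcases ha with h | h | h
    · have hθ : θSq a = 0 := Subtype.ext h
      rw [hθ, H.eq_fst _ (by simp)]
      exact L.map_coe hf.continuous_leafMap ▸ rfl
    · rw [h, show (2 : ℝ) * 1 - 1 = 1 by norm_num, projIcc_right,
        show (⟨1, right_mem_Icc.2 zero_le_one⟩ : I) = 1 from rfl, H.apply_one]
      rfl
    · have hθ : θSq a = 1 := Subtype.ext h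
      rw [hθ, H.eq_fst _ (by simp)]
      show (L.map hf.continuous_leafMap) 1 = q₀
      rw [Path.target]
  -- the lift `G` of `g` from the pushed initial germ `d₀`
  set d₀ : T.GermSpace := hf.pushGerm (C.Γ 0) with hd₀def
  have hd₀ : d₀.proj = g (mkSq 0 0) := by
    rw [hg_low _ (by show ((0 : I) : ℝ) ≤ 1 / 2; norm_num), θSq_mkSq]
    show leafMap F T f (C.Γ 0).proj = leafMap F T f (toLeafSpace (C.Φ 0 τ₀))
    rw [C.Φ_baseLevel]
    exact congrArg (leafMap F T f) (congr_fun C.proj_comp 0)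
  obtain ⟨G, ⟨hG₀, hGg⟩, -⟩ := (T.isCoveringMap_proj).existsUnique_continuousMap_lifts g (mkSq 0 0) d₀ hd₀
  have hGproj : ∀ a, (G a).proj = g a := fun a ↦ congr_fun hGg a
  -- levels
  have hlev0 : GermSpace.level d₀ = τ₀ := by
    rw [hd₀def, hf.level_pushGerm, C.apply_zero, GermSpace.level_ofHeight]
    rfl
  have hlev : ∀ a, GermSpace.level (G a) = τ₀ := fun a ↦ by
    rw [T.level_apply_eq_of_preconnectedSpace G a (mkSq 0 0), hG₀, hlev0]
  -- the pushed fence over `I`, pulled back to the square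
  obtain ⟨δ₀, hδ₀, hδ₀ε, hP⟩ := hf.exists_isFenceOn_comp C.Γ C.ε_pos C.isFenceOn
  have hP₂ : IsFenceOn T ((hf.pushGerm ∘ C.Γ) ∘ θSq) τ₀ δ₀ (fun a τ ↦ f (C.Φ (θSq a) τ)) univ :=
    hP.comp_right continuous_θSq
  -- `G` agrees with the pushed family on the lower half `S₀`
  set S₀ : Set Sq := {a | (a : ℝ × ℝ).1 < 1 / 2} with hS₀def
  have hS₀o : IsOpen S₀ := isOpen_lt (continuous_fst.comp continuous_subtype_val) continuous_const
  have ha₀S₀ : mkSq 0 0 ∈ S₀ := by show ((0 : I) : ℝ) < 1 / 2; norm_num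
  have hS₀pre : IsPreconnected S₀ := by
    rw [← Topology.IsInducing.subtypeVal.isPreconnected_image]
    have hconv : Convex ℝ (Subtype.val '' S₀) := by
      have heq : Subtype.val '' S₀ = sqSet ∩ {p : ℝ × ℝ | p.1 < 1 / 2} := by
        ext p
        constructor
        · rintro ⟨a, ha, rfl⟩
          exact ⟨a.2, ha⟩
        · rintro ⟨hp, hp'⟩
          exact ⟨⟨p, hp⟩, hp', rfl⟩
      rw [heq]
      exact convex_sqSet.inter (convex_halfSpace_lt (LinearMap.fst ℝ ℝ ℝ).isLinear _)
    exact hconv.isPreconnected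
  set G' : C(Sq, T.GermSpace) :=
    ⟨fun a ↦ hf.pushGerm (C.Γ (θSq a)), hf.continuous_pushGerm.comp (C.Γ.continuous.comp continuous_θSq)⟩
    with hG'def
  have hGeq : ∀ a ∈ S₀, G a = G' a := by
    intro a ha
    refine apply_eq_of_proj_eq G G' hS₀pre (fun a' ha' ↦ ?_) ha₀S₀ ?_ ha
    · rw [hGproj, hg_low a' (le_of_lt ha')]
      show _ = leafMap F T f (C.Γ (θSq a')).proj
      rw [C.Φ_baseLevel]
      exact congrArg (leafMap F T f) (congr_fun C.proj_comp (θSq a')).symm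
    · rw [hG₀]
      rfl
  -- the initial fence over `S₀`
  have h₀ : IsFenceOn T G τ₀ δ₀ (fun a τ ↦ f (C.Φ (θSq a) τ)) S₀ :=
    (hP₂.mono (subset_univ S₀) le_rfl).congr_germ fun a ha ↦ hGeq a ha
  -- relative extension over the whole square, unchanged near the edge `t = 0`
  set K₀ : Set Sq := {a | (a : ℝ × ℝ).1 ≤ 1 / 4} with hK₀def
  have hK₀c : IsCompact K₀ := (isClosed_le (continuous_fst.comp continuous_subtype_val) continuous_const).isCompact
  have hK₀S₀ : K₀ ⊆ S₀ := fun a ha ↦ by show (a : ℝ × ℝ).1 < 1 / 2; exact lt_of_le_of_lt ha (by norm_num)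
  obtain ⟨ε₁, hε₁, Ψ, hΨ, V, hVo, hK₀V, hΨeq⟩ :=
    exists_isFenceOn_univ_of_isFenceOn G hlev hδ₀ h₀ hS₀o hK₀c hK₀S₀
  -- the edge datum: a box `ê₀` of `T` at `f (γ 0)` with `h_{e₀} = φ̂ ∘ h_{ê₀} ∘ f`
  obtain ⟨ê₀, hê₀, hfx₀⟩ := T.exists_mem_source (f (loopBase γ))
  obtain ⟨φh, hφh, hcomp⟩ := hf.exists_compat C.box_mem C.base_mem hê₀ hfx₀
  have hφht : φh (ê₀ (f (loopBase γ))).2 = τ₀ := IsFoliatedMap.apply_height_eq hcomp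
  have hd₀germ : d₀.germ = ↑(φh ∘ height ê₀) := by
    rw [hd₀def, C.apply_zero]
    exact hf.pushGerm_ofHeight C.box_mem C.base_mem hê₀ hfx₀ hφh hcomp
  obtain ⟨κ, hκ, hκt, hκφ, hφκ⟩ := hφh.exists_inverse
  rw [hφht] at hκ hκt hφκ
  obtain ⟨ρ₁, hρ₁, hκc, hκm⟩ := hκ
  have hκinj : InjOn κ (Ioo (τ₀ - ρ₁) (τ₀ + ρ₁)) := hκm.elim StrictMonoOn.injOn StrictAntiOn.injOn
  obtain ⟨ρ₂, hρ₂, hρ₂sub⟩ := IsHomeoGermAt.exists_Ioo_subset_of_mem_nhds hφκ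
  set ρ : ℝ := min ρ₁ ρ₂ with hρdef
  have hρ : 0 < ρ := lt_min hρ₁ hρ₂
  have hIρ₁ : Ioo (τ₀ - ρ) (τ₀ + ρ) ⊆ Ioo (τ₀ - ρ₁) (τ₀ + ρ₁) :=
    Ioo_subset_Ioo (by linarith [min_le_left ρ₁ ρ₂]) (by linarith [min_le_left ρ₁ ρ₂])
  have hIρ₂ : Ioo (τ₀ - ρ) (τ₀ + ρ) ⊆ Ioo (τ₀ - ρ₂) (τ₀ + ρ₂) :=
    Ioo_subset_Ioo (by linarith [min_le_right ρ₁ ρ₂]) (by linarith [min_le_right ρ₁ ρ₂])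
  set U : Set Sq := {a | G a = d₀} with hUdef
  have hd₀pt : ofLeafSpace d₀.pt = f (loopBase γ) := by
    rw [hd₀def, C.apply_zero]
    rfl
  let D : LocalDatum T G τ₀ ρ U :=
    { box := ê₀
      box_mem := hê₀
      φ := φh
      ψ := κ
      germ_eq := fun a ha ↦ by rw [show G a = d₀ from ha]; exact hd₀germ
      pt_mem := fun a ha ↦ by
        rw [show G a = d₀ from ha, hd₀pt]
        exact ⟨hfx₀, hκt.symm ▸ rfl⟩
      φ_ψ := fun τ hτ ↦ hρ₂sub (hIρ₂ hτ)
      ψ_φ := by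
        show ∀ᶠ r in 𝓝 (κ τ₀), κ (φh r) = r
        rw [hκt]
        exact hκφ
      ψ_cont := hκc.mono hIρ₁
      ψ_inj := hκinj.mono hIρ₁ }
  -- the three edges lie in `U`: `G` is constant there, lying over the constant `q₀`
  have hEU : range edge₃ ⊆ U := by
    intro a ha
    have hq : ∀ a' ∈ range edge₃, (G a').proj = q₀ := fun a' ha' ↦ by
      rw [hGproj, hg_edge a' (range_edge₃_subset ha')]
    have hcorner : mkSq 0 0 ∈ range edge₃ := ⟨0, edge₃.source⟩
    show G a = d₀
    rw [apply_eq_of_proj_eq_const G isPreconnected_edgeSet_range hq ha hcorner, hG₀]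
  obtain ⟨δE, hδE, hδEε₁, hlevE⟩ := hΨ.exists_forall_level isOpen_univ hε₁ D
    (isCompact_range edge₃.continuous) (subset_univ _) hEU
  -- the level radius
  set δ : ℝ := min δE C.ε with hδdef
  have hδ : 0 < δ := lt_min hδE C.ε_pos
  refine ⟨δ, hδ, min_le_right _ _, fun τ hτ ↦ ?_⟩
  have hτE : τ ∈ Ioo (τ₀ - δE) (τ₀ + δE) :=
    Ioo_subset_Ioo (by linarith [min_le_left δE C.ε]) (by linarith [min_le_left δE C.ε]) hτ
  have hτε₁ : τ ∈ Ioo (τ₀ - ε₁) (τ₀ + ε₁) := Ioo_subset_Ioo (by linarith) (by linarith) hτE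
  have hτC : τ ∈ Ioo (τ₀ - C.ε) (τ₀ + C.ε) :=
    Ioo_subset_Ioo (by linarith [min_le_right δE C.ε]) (by linarith [min_le_right δE C.ε]) hτ
  -- the leaf map of level `τ` from the square
  set Ψτ : C(Sq, T.LeafSpace) := ⟨fun a ↦ toLeafSpace (Ψ a τ), hΨ.continuous_toLeafSpace hτε₁⟩ with hΨτ
  -- along the edge `t = 0` it is `f ∘ h_τ`
  have hbot : ∀ θ : I, Ψτ (mkSq 0 θ) = leafMap F T f (toLeafSpace (C.Φ θ τ)) := fun θ ↦ by
    show toLeafSpace (Ψ (mkSq 0 θ) τ) = toLeafSpace (f (C.Φ θ τ))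
    rw [hΨeq _ (hK₀V (by show ((0 : I) : ℝ) ≤ 1 / 4; norm_num)) τ hτε₁, θSq_mkSq]
  have hx : leafMap F T f (toLeafSpace (vert γ e₀ τ)) = Ψτ (mkSq 0 0) := by
    rw [hbot, C.Φ_zero hτC]
  have hy : leafMap F T f (toLeafSpace (vert γ e₀ τ)) = Ψτ (mkSq 0 1) := by
    rw [hbot, C.Φ_one hτC]
  have h₁ : (C.horizPath τ).map hf.continuous_leafMap = (edge₀.map Ψτ.continuous).cast hx hy := by
    ext θ
    rw [Path.map_coe, Path.cast_coe, Path.map_coe, comp_apply, comp_apply, C.horizPath_apply hτC,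
      edge₀_apply, hbot]
  -- the edge `t = 0` is homotopic to the three-edge path, mapped by `Ψτ`
  have h₂ : ((edge₀.map Ψτ.continuous).cast hx hy).Homotopic ((edge₃.map Ψτ.continuous).cast hx hy) :=
    homotopic_edge₀_edge₃.map Ψτ
  -- the three-edge path runs in one plaque
  have h₃ : ((edge₃.map Ψτ.continuous).cast hx hy).Homotopic (Path.refl _) := by
    refine T.homotopic_refl_of_forall_mem_plaque hê₀ (t := κ τ) _ fun s ↦ ?_
    show Ψ (edge₃ s) τ ∈ plaque ê₀ (κ τ)
    exact hlevE (edge₃ s) ⟨s, rfl⟩ τ hτE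
  rw [h₁]
  exact h₂.trans h₃

end Transport

end Literature.Topology.PlanarFoliations
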